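import Summits.CriticalPhenomena.PercolationContinuityZ3.Theorems.Transplant.CayleySkeletonFrmFrom
import Summits.CriticalPhenomena.PercolationContinuityZ3.Theorems.Transplant.CayleyNilpotentFrom
import Summits.CriticalPhenomena.PercolationContinuityZ3.Theorems.Transplant.CayleyCommutatorWalks
import HarnessLib

/-!
# `NilFrm.Data` — every finitely generated nilpotent group with ANY unit-range alphabet is a `CayleyFrm₃`: θ(p_c) = 0 modulo the universal node, INPUT = (φ)

builds on p205010 (kernel theorem, internal audit signed; external expert review pending) — nothing in this file uses p205010.  The percolation
conclusions are CONDITIONAL on the OPEN node `SamePDropOfSkeletonFrmFrom₁` (file `PlanarSkeletonFrmFromDefs`; hypothesis `hN`, nothing claimed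
about it); Φ2 (`cylSubcritical_unitRange`) is unconditional.  Lane `prim-bschramm`, seat `prim-bschramm-p4` gen 13 (PART C3 of `P4-GENERAL.md`
§35.3/§35.7).  Helper file (`--supports stmt-CriticalPhenomena-4575 --as helper`).

**`NilFrm.Data Γ`** := gen 12's `NilNeg.NegData` minus `ν` AND minus the letters-type restriction: a nilpotent group of ANY class with a finite
symmetric generating `A` and an additive `φ` of UNIT RANGE on `A` (`‖φ(a)‖_∞ ≤ 1`: diagonal and doubled letters allowed) with unit steps `x, y ∈ A` —
NO automorphism, NO cylinder condition.  The kernel is generated by the finite set of kernel letters and left-normed commutators of the COMPANION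
ALPHABET `{x^{±1}, y^{±1}} ∪ {π(a)^{±1}}` (file `CayleyCommutatorWalks` + KerGen; `K_spec`), so `Cay(Γ; A)` carries a `CayleyFrm₃` and
**`NilFrm.Data.theta_eq_zero_of_le_of_frmFromNode₁`: modulo the universal node, θ_g(p) = 0 ∀ p ≤ p_c on `Cay(Γ; A)` for EVERY finitely generated
nilpotent group and EVERY finite symmetric generating set carrying a unit-range chart with unit steps** — the end state of the C3 class map at the
Cayley level: INPUT = (φ).  Forgetful maps from `NilNeg.NegData` (gen 12) and `NilThreeFrm.Data` (gen 13); the letters-only free nilpotent groups of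
every class (`FreeNilClass.cayleyFrm₃`).  Unconditional today: class ≤ 2 with ν and any unit-range alphabet (`theta_eq_zero_of_le_classTwo`), class ≤ 3
letters-type with ν (`NilThreeNeg.NegData`), any class with ν and `C_1` connected (`CayleyNeg₂`).
[cite: BenjaminiSchramm1996, Conj. 4; §2 (Cayley graphs)] [cite: KozmaNitzan2024, §1 p. 2 (approach 1); §4 p. 16 (Lemma 8)]
[cite: AizenmanGrimmett1991, Thm 1 (essential enhancements)]
-/

noncomputable section

namespace Summit.CriticalPhenomena.PercolationContinuityZ3.Theorems.Transplant

open SimpleGraph Walk Subgroup Literature.Probability.LatticeModels Literature.Probability.Percolation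
open Literature.Barriers.CriticalPhenomena (countable_of_connected_of_locallyFinite)
open scoped commutatorElement Classical

/-! ## §2 `NilFrm.Data`: nilpotent of ANY class, letters only, NO automorphism -/

namespace NilFrm

/-- **The input: a finitely generated nilpotent group (any class) with a UNIT-RANGE rank-2 chart with unit steps — NO symmetry, NO letters-type
restriction** (`NilNeg.NegData` without `ν` and with `letters` weakened to `lip`). [cite: KozmaNitzan2024, §4 p. 16 (Lemma 8)] [cite: BenjaminiSchramm1996, §2] -/
structure Data (Γ : Type) [Group Γ] where
  /-- the generators -/
  A : Finset Γ
  /-- the generators are symmetric -/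
  symm : ∀ a ∈ A, a⁻¹ ∈ A
  /-- the generators generate -/
  gen : Subgroup.closure (A : Set Γ) = ⊤
  /-- the class bound: `Γ` has class `≤ c + 1` -/
  c : ℕ
  /-- nilpotency -/
  nil : (⊤ : Subgroup Γ).lowerCentralSeries (c + 1) = ⊥
  /-- the chart -/
  φ : Γ → Site 2
  /-- additivity -/
  map_mul : ∀ g h : Γ, φ (g * h) = φ g + φ h
  /-- the first unit step -/
  x : Γ
  /-- it is a generator -/
  x_mem : x ∈ A
  /-- its height -/
  φ_x : φ x = Pi.single 0 1
  /-- the second unit step -/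
  y : Γ
  /-- it is a generator -/
  y_mem : y ∈ A
  /-- its height -/
  φ_y : φ y = Pi.single 1 1
  /-- UNIT RANGE: every generator has sup-norm `≤ 1` -/
  lip : ∀ a ∈ A, ∀ i : Fin 2, |φ a i| ≤ 1

namespace Data

variable {Γ : Type} [Group Γ] (D : Data Γ)

/-- The base datum (chart and the two unit steps). [folklore] -/
def base : CayCyl.CylBase Γ D.A where
  φ := D.φ
  map_mul := D.map_mul
  lip := D.lip
  s₀ := D.x
  s₀_mem := D.x_mem
  φ_s₀ := D.φ_x
  s₁ := D.y
  s₁_mem := D.y_mem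
  φ_s₁ := D.φ_y

/-- The kernel generators as a set: kernel letters of the companion alphabet and its left-normed commutators of weights `2 … c + 1`. [folklore] -/
def KK : Set Γ := {a | a ∈ D.base.compAlph ∧ D.φ a = 0} ∪ ⋃ k ∈ Finset.range D.c, KerGen.W D.base.compAlph (k + 1)

/-- **THE FINITE KERNEL GENERATING SET** (a `Finset`; finiteness: the companion alphabet is finite, hence so are its commutators of each weight).
[folklore] -/
noncomputable def K : Finset Γ :=
  (show D.KK.Finite from by
    have hA : D.base.compAlph.Finite :=
      Set.Finite.union (Set.toFinite _) (Set.Finite.union (Set.Finite.image _ D.A.finite_toSet) (Set.Finite.image _ D.A.finite_toSet))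
    have hW : ∀ k : ℕ, (KerGen.W D.base.compAlph k).Finite := by
      intro k
      induction k with
      | zero => exact hA
      | succ k ih => rw [KerGen.W_succ]; exact Set.Finite.image2 _ hA ih
    exact Set.Finite.union (hA.subset fun _ h => h.1)
      (Set.Finite.biUnion (Finset.range D.c).finite_toSet fun k _ => hW (k + 1))).toFinset

/-- Membership in `K` is membership in `KK`. [folklore] -/
theorem mem_K_iff {s : Γ} : s ∈ D.K ↔ s ∈ D.KK := by
  rw [K, Set.Finite.mem_toFinset]

/-- **THE KERNEL IS FINITELY GENERATED, EXPLICITLY**: the generators lie in `ker φ` and generate it (KerGen's criterion for the companion alphabet;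
weights `> c + 1` vanish). [folklore] -/
theorem K_spec : (∀ s ∈ D.K, D.φ s = 0) ∧ ∀ g : Γ, D.φ g = 0 → g ∈ Subgroup.closure (D.K : Set Γ) := by
  constructor
  · intro s hs
    rcases (D.mem_K_iff.1 hs) with ⟨-, h⟩ | h
    · exact h
    · obtain ⟨k, -, hk⟩ := Set.mem_iUnion₂.1 h
      obtain ⟨a, -, w', -, rfl⟩ := hk
      exact KerGen.phi_commutatorElement D.φ D.map_mul a w'
  · intro g hg
    have h := KerGen.mem_closure_of_eq_zero (A := D.base.compAlph) D.φ D.map_mul (D.base.closure_compAlph D.gen) D.base.compAlph_symm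
      D.φ_x D.φ_y D.base.compAlph_letters hg
    refine (Subgroup.closure_le _).2 ?_ h
    rintro t (⟨ht, ht0⟩ | ht)
    · exact Subgroup.subset_closure (Finset.mem_coe.2 (D.mem_K_iff.2 (Or.inl ⟨ht, ht0⟩)))
    · obtain ⟨k, hk⟩ := Set.mem_iUnion.1 ht
      by_cases hkc : k < D.c
      · exact Subgroup.subset_closure (Finset.mem_coe.2 (D.mem_K_iff.2 (Or.inr (Set.mem_iUnion₂.2 ⟨k, Finset.mem_range.2 hkc, hk⟩))))
      · have h1 : t = 1 := KerGen.W_eq_one_of_lowerCentralSeries_eq_bot D.nil (by omega) hk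
        rw [SetLike.mem_coe, h1]; exact Subgroup.one_mem _

/-- **The `CayleyFrm₃` of `Cay(Γ; A)`** (finitely generated kernel, no automorphism, any unit-range alphabet).
[cite: KozmaNitzan2024, §4 p. 16 (Lemma 8)] -/
def cayleyFrm₃ : CayleyFrm₃ Γ D.A :=
  CayleyFrm₃.ofGens D.φ D.map_mul D.lip
    (fun i => by
      fin_cases i
      · exact ⟨D.x, D.x_mem, D.φ_x⟩
      · exact ⟨D.y, D.y_mem, D.φ_y⟩)
    D.gen D.K D.K_spec.1 D.K_spec.2

/-- `cayleyFrm₃.φ = φ`. [folklore] -/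
@[simp] theorem cayleyFrm₃_φ : D.cayleyFrm₃.φ = D.φ := rfl

/-- **Φ2 (UNCONDITIONAL): no cylinder of `Cay(Γ; A)` percolates at any `p ≤ p_c`** (nilpotent, any class, any unit-range alphabet, no symmetry).
[cite: AizenmanGrimmett1991, Thm 1 (essential enhancements)] -/
theorem cylSubcritical_unitRange {p : unitInterval} (hp : (p : ℝ) ≤ criticalProb (mulCayley (↑D.A : Set Γ)) (1 : Γ)) :
    D.cayleyFrm₃.skeletonFrmFrom.CylSubcritical p :=
  D.cayleyFrm₃.cylSubcritical_of_le' hp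

include D in
/-- **CONDITIONAL THEOREM (end state of the C3 class map at the Cayley level): `θ_g(p) = 0` for every `p ≤ p_c` at every vertex of `Cay(Γ; A)`
for a finitely generated nilpotent group of ANY class and ANY finite symmetric generating set carrying a unit-range rank-2 chart with unit steps —
NO automorphism, NO letters-type restriction, NO cylinder condition — modulo the universal one-type node `SamePDropOfSkeletonFrmFrom₁`** (OPEN;
hypothesis `hN`).  Unconditional today when a reversing automorphism exists AND (class ≤ 2, or class ≤ 3 letters-type, or `C_1` connected)
(`theta_eq_zero_of_le_classTwo`, `NilThreeNeg.NegData`, `CayleyNeg₂`).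
builds on p205010 (kernel theorem, internal audit signed; external expert review pending). [cite: BenjaminiSchramm1996, Conj. 4; §2]
[cite: KozmaNitzan2024, §1 p. 2 (approach 1)] -/
theorem theta_eq_zero_of_le_of_frmFromNode₁ (hN : SamePDropOfSkeletonFrmFrom₁) (g : Γ) {p : unitInterval}
    (hp : (p : ℝ) ≤ criticalProb (mulCayley (↑D.A : Set Γ)) g) : theta (mulCayley (↑D.A : Set Γ)) g p = 0 :=
  D.cayleyFrm₃.theta_eq_zero_of_le_of_frmFromNode₁ hN g hp

include D in
/-- **`θ_g(p_c) = 0` on `Cay(Γ; A)`, any class, any unit-range alphabet, no symmetry, modulo the universal node.** [cite: BenjaminiSchramm1996, Conj. 4; §2] -/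
theorem criticalContinuity_of_frmFromNode₁ (hN : SamePDropOfSkeletonFrmFrom₁) (g : Γ) :
    theta (mulCayley (↑D.A : Set Γ)) g (criticalProbIOf (mulCayley (↑D.A : Set Γ)) g) = 0 :=
  D.theta_eq_zero_of_le_of_frmFromNode₁ hN g le_rfl

end Data

/-- Forgetting the automorphism: every `NilNeg.NegData` (gen 12) is a `NilFrm.Data` (letters-type ⟹ unit range). [folklore] -/
def ofNegData {Γ : Type} [Group Γ] (T : NilNeg.NegData Γ) : Data Γ where
  A := T.A
  symm := T.symm
  gen := T.gen
  c := T.c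
  nil := T.nil
  φ := T.φ
  map_mul := T.map_mul
  x := T.x
  x_mem := T.x_mem
  φ_x := T.φ_x
  y := T.y
  y_mem := T.y_mem
  φ_y := T.φ_y
  lip := fun _ hs i => T.lip_letters hs i

/-- Forgetting the class bound `3`: every `NilThreeFrm.Data` (gen 13) is a `NilFrm.Data` with `c = 2`. [folklore] -/
def ofNilThreeFrm {Γ : Type} [Group Γ] (T : NilThreeFrm.Data Γ) : Data Γ where
  A := T.A
  symm := T.symm
  gen := T.gen
  c := 2
  nil := T.nil
  φ := T.φ
  map_mul := T.map_mul
  x := T.x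
  x_mem := T.x_mem
  φ_x := T.φ_x
  y := T.y
  y_mem := T.y_mem
  φ_y := T.φ_y
  lip := T.base.lip

end NilFrm

/-! ## §3 The letters-only free nilpotent groups of EVERY class, no symmetry needed -/

namespace FreeNilClass

/-- **The `CayleyFrm₃` of the letters-only `N_{m+2,c+1}`, every class** (drop `ν` from gen 12's `cayleyNeg₃`). [cite: KozmaNitzan2024, §4 p. 16 (Lemma 8)] -/
def cayleyFrm₃ (m c : ℕ) : CayleyFrm₃ (N m c) (AL m c) := CayleyFrm₃.ofNeg₃ (cayleyNeg₃ m c)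

/-- **CONDITIONAL THEOREM: `θ_g(p) = 0` for every `p ≤ p_c` at every vertex of the LETTERS-ONLY Cayley graph of the free nilpotent group
`N_{m+2,c+1}` of EVERY rank and class, modulo the universal one-type node** (for class `≥ 4` these graphs violate (κ) under every flat chart,
P4-GENERAL §35.2; today's unconditional rows stop at class 3). builds on p205010 (kernel theorem, internal audit signed; external expert review pending).
[cite: BenjaminiSchramm1996, Conj. 4; §2] -/
theorem letters_theta_eq_zero_of_le_of_frmFromNode₁ (m c : ℕ) (hN : SamePDropOfSkeletonFrmFrom₁) (g : N m c) {p : unitInterval}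
    (hp : (p : ℝ) ≤ criticalProb (mulCayley (↑(AL m c) : Set (N m c))) g) :
    theta (mulCayley (↑(AL m c) : Set (N m c))) g p = 0 :=
  (cayleyFrm₃ m c).theta_eq_zero_of_le_of_frmFromNode₁ hN g hp

end FreeNilClass

end Summit.CriticalPhenomena.PercolationContinuityZ3.Theorems.Transplant

end
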